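import Mathlib.Analysis.SpecificLimits.Basic
import HarnessLib

/-!
# From scale-invariant oscillation decay to constancy

Analysis/FluidPDE proofs file (theorems only). The last step of Nash–Moser arguments for
*bounded ancient* solutions: if the oscillation `J(R)` of a bounded function over the
(parabolic) cylinder of radius `R` satisfies the scale-invariant decay `J(θR) ≤ κ J(R)` for all
`R > 0`, with fixed `0 < θ < 1` and `0 ≤ κ < 1`, then `J ≡ 0`. This replaces, for the named fact
`Literature.Analysis.FluidPDE.LeiZhang2011_liouville` (Lei–Zhang, J. Funct. Anal. 261 (2011) =
arXiv:1011.5066, Theorem 1.2), the Hölder-continuity formulation of their Theorem 1.1 and the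
limit `L → ∞` of the printed proof (p. 12: "Letting `L → ∞`, we find that
`Γ(x,t) = Γ(0,0)`"): iterating the oscillation estimate (3.8)
`osc_{P(√c₀R/2)} Γ ≤ (1 − δ/4) osc_{P(R)} Γ` *upwards* in `R` and using `|Γ| ≤ C₀` gives
`osc_{P(R)} Γ ≤ (1 − δ/4)^k · 2C₀ → 0`.

* `eq_zero_of_forall_le_mul_of_bounded` — `J(θR) ≤ κ J(R)` for all `R > 0`, `0 ≤ J ≤ M`
  ⟹ `J(R) = 0` for all `R > 0`.

## References

* Z. Lei, Q. S. Zhang, J. Funct. Anal. 261 (2011) = arXiv:1011.5066, (3.8) p. 12 and the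
  proof of Theorem 1.2, first paragraph (p. 12). [LeiZhang2011]
-/

noncomputable section

open Filter
open scoped Topology

namespace Literature.Analysis.FluidPDE

namespace LeiZhang2011

/-- **Scale-invariant oscillation decay of a bounded quantity forces it to vanish.** If
`J : ℝ → ℝ` satisfies `0 ≤ J R ≤ M` and `J (θ R) ≤ κ J R` for all `R > 0`, with `θ > 0` (in
applications `θ < 1`) and `0 ≤ κ < 1`, then `J R = 0` for all `R > 0`:
`J R ≤ κ^k J (R/θ^k) ≤ κ^k M → 0`. This is how the oscillation estimate (3.8) of
Lei–Zhang 2011, valid at every scale with constants depending only on `‖b‖_E`, yields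
`osc Γ ≡ 0` for a bounded ancient solution, i.e. the conclusion "`Γ ≡ Γ(0,0)`" of the first
paragraph of the printed proof of Theorem 1.2. [cite: LeiZhang2011, (3.8) and proof of Thm. 1.2, first paragraph (arXiv p. 12)] -/
theorem eq_zero_of_forall_le_mul_of_bounded {J : ℝ → ℝ} {θ κ M : ℝ} (hθ : 0 < θ)
    (hκ0 : 0 ≤ κ) (hκ1 : κ < 1) (hJ0 : ∀ R, 0 < R → 0 ≤ J R) (hJM : ∀ R, 0 < R → J R ≤ M)
    (hdecay : ∀ R, 0 < R → J (θ * R) ≤ κ * J R) {R : ℝ} (hR : 0 < R) : J R = 0 := by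
  -- `J R ≤ κ^k J (R / θ^k)` for every `k`
  have hiter : ∀ k : ℕ, J R ≤ κ ^ k * J (R / θ ^ k) := by
    intro k
    induction k with
    | zero => simp
    | succ k ih =>
      have hRk : 0 < R / θ ^ (k + 1) := div_pos hR (pow_pos hθ _)
      have h := hdecay (R / θ ^ (k + 1)) hRk
      have e : θ * (R / θ ^ (k + 1)) = R / θ ^ k := by
        rw [pow_succ]
        field_simp
      rw [e] at h
      calc J R ≤ κ ^ k * J (R / θ ^ k) := ih
        _ ≤ κ ^ k * (κ * J (R / θ ^ (k + 1))) := mul_le_mul_of_nonneg_left h (pow_nonneg hκ0 k)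
        _ = κ ^ (k + 1) * J (R / θ ^ (k + 1)) := by rw [pow_succ]; ring
  have hbound : ∀ k : ℕ, J R ≤ κ ^ k * M := fun k =>
    (hiter k).trans (mul_le_mul_of_nonneg_left (hJM _ (div_pos hR (pow_pos hθ _)))
      (pow_nonneg hκ0 k))
  -- `κ^k M → 0`
  have hlim : Tendsto (fun k : ℕ => κ ^ k * M) atTop (𝓝 (0 * M)) :=
    (tendsto_pow_atTop_nhds_zero_of_lt_one hκ0 hκ1).mul_const M
  rw [zero_mul] at hlim
  have hle : J R ≤ 0 := ge_of_tendsto' hlim hbound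
  exact le_antisymm hle (hJ0 R hR)

end LeiZhang2011

end Literature.Analysis.FluidPDE
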